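import Literature.MathematicalPhysics.QuantumFieldTheory.Balaban1983to89.B11Thm1ExistsUniqueCoP7MG

/-!
# `Balaban1983to89.B11Thm1ExistsUniqueStepTokensG` — [Balaban1985Variational] = «[15]», Theorem 1 p. 279 (existence ∕ uniqueness half): THE PRODUCER SHAPE — print's ONE-LENGTH STEP
# «given an approximate minimiser `U₀` with (14)» (p. 280) as a NAMED TOKEN, the companion token «an approximate minimiser exists» ((11)–(13) pp. 279–280), and the PROVED reductions
# of the guard-generic named fact `B11Thm1ExistsUniqueCoP7MG.VariationalThm1EUSep{Top,CoP}7MG` (#10741) to them — the (E∕U) analogue of K0's `Node00.Prop8RegSepTopStepG` ∕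
# `variationalThm1RegSepCoP7MG_of_prop8TopStepG` for the (R) half

Honest framing: statement-level skeleton of published theorems with citation tags; proofs where landed; nothing here is a claim about the Yang–Mills mass gap.  Cell `pub-ymgap`
(HUMAN RULINGS D-0062 ∕ D-0149), lane `pub-ymgap-dag-n12-c` g33 (R134 seat (a), N12 = [B15], s1 — the CONSUMER lane of the (E∕U) fact; natural owner of a PRODUCER = an N07 ∕ NODE-00
seat); `--kind definition --supports` K1⁹ `stmt-QuantumFields-27364`; count-neutral; N12 NOT discharged; finite 𝕋⁴ at fixed ε; nothing continuum ∕ ℝ⁴ ∕ OS ∕ mass-gap ∕ Clay.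
Named `Prop`s WITH PARAMETERS, NEVER ASSERTED (no `sorry`, no `axiom`, no `instance`); the theorems are compositions BY NAME.

WHY.  After the chair's BATCH 65 (2026-08-30) N12's junction of record «12Q-DIRECT v14ᴸ» (#10983,
`Summits/…/BalabanUVNodesN12AtRecord13Prop1KnitThm1WindowDirectDatumScaleLettersDischargedAtLengthOfThm1NamedFactsGOfRecord`) displays exactly TWO undischarged [15] inputs: the (R)
half `Node00.VariationalThm1RegSepCoP7MG F 2 Adm B₃ a₀ a₁` — which HAS a producer shape (K0's one-step token `Node00.Prop8RegSepTopStepG` = [15] Prop. 8 at the top step for every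
fibre-critical configuration, and dag-n07-e's reduction `variationalThm1RegSepCoP7MG_of_prop8TopStepG`; K0⁷'s registered stub) — and the (E∕U) half
`B11Thm1ExistsUniqueCoP7MG.VariationalThm1EUSepCoP7MG F 2 Adm B₃ a₀ a₁`, which so far has NO producer, NO item and NO producer SHAPE.  THIS FILE supplies the shape, read off print:

THE PRINT ([15] pp. 279–281, first-hand).  *«Theorem 1 will be proved by induction with respect to k»* (p. 279) — but the induction serves ONE purpose: to manufacture, from the
length-`(k−1)` minimiser with the datum `V₀` of (11), a configuration `U₀` satisfying (13), and then (p. 280) *«Having in view future applications we will consider a little bit more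
general configuration U₀ than this constructed above. We assume that we have a configuration U₀ satisfying U₀ ∈ U_k({Ω_j}, C₁B₃ε₁), |U₀ − V| < C₁ε₁ on Λ_j, j = 0, 1, …, k, (14) for
some absolute constant C₁ … for k = 1 we do not have any solutions of the variational problem yet, and then we take simply U₀ = V₀»*.  GIVEN such a `U₀` the rest of the proof is at ONE
length: Sect. A fixes the axial gauge `Ax_k(𝔅_k, U₀)` and maps the space (18) one-to-one onto the Landau-gauge chart (19)–(21) by [6] Thm 2 — *«Proposition 2. All critical orbits of the
functional (5) in the space (6) … can be obtained by taking critical configurations U₁ of the functional A(U₁U₀) in the space defined by (19)–(21), where U₀ satisfies (14)»* (p. 281) —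
and Sects. B–E prove *«that for ε₁, ε₂ sufficiently small there exists exactly one critical configuration, which is a minimum of the functional (5)»* (p. 281; (141)–(142) p. 299).
So the (E∕U) conclusion at `(s, W)` follows from the EXISTENCE OF ONE APPROXIMATE MINIMISER `U₀` with (14) plus the one-length analysis around it.

CONTENTS.
* §1 `ApproxMinTop av Ω Ω₀ k ρ W U₀` — print's (14) in NODE 00's house: `U₀` is `ρ_n`-REGULAR on the class ranges (plaquettes MEETING `Ω_n` at `ρ_n·η_n²`, co-divergence at
  `ρ_n·η_n³` — the SHAPE of (8)'s conclusion in `Node00.VariationalThm1RegSepTop7MG`) AND its averages AGREE with the datum on the determining set (`AgreeOn (genSet Ω k) (avgFamily av U₀)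
  W` — print's «|U₀ − V| < C₁ε₁ on Λ_j» at distance ZERO: the weakest token that still yields the name; the induction's `U₀` of (13) and the `k = 1` choice `U₀ = V₀` agree EXACTLY).
  -- TODO(general form): print's (14) allows `|U₀ − V| < C₁ε₁`; the `C₁`-close edition is what [15] Sect. G ∕ [16] use when `V` varies at fixed `U₀` — not needed for Theorem 1 itself.
* §2 ★ THE ONE-LENGTH STEP TOKENS `VariationalThm1EUStepTop7MG F N Sup Adm C₁ B₃ a₀ a₁` ∕ `…StepCoP7MG` := the binders of `VariationalThm1EUSepTop7MG` VERBATIM (incl. `0 < k`, the guard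
  `Adm`, the thresholds, the datum `W` with (7)) `→ ∀ U₀, ApproxMinTop … k (fun n => C₁·B₃·δ n) W U₀ →` the (E∕U) conclusion VERBATIM.  [15] Prop. 2 + Sects. B–E; NEVER asserted.
* §3 THE SUPPLY TOKENS `ApproxMinimiserExistsTop7MG F N Sup Adm C₁ B₃ a₀ a₁` ∕ `…CoP7MG` := the same binders `→ ∃ U₀, ApproxMinTop …`.  [15] (11)–(13); NEVER asserted.
* The definitional bridges `variationalThm1EUStepCoP7MG_iff` ∕ `approxMinimiserExistsCoP7MG_iff` (`Iff.rfl`).  THIS FILE STAYS STATEMENT-ONLY; the PROVED reductions live in the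
  sibling THEOREMS-ONLY module `B11Thm1ExistsUniqueStepTokensGBridges`: ★★ `variationalThm1EUSepTop7MG_of_step_of_approxExists` (NAME ⇐ §2 ∧ §3, pointwise) and its `CoP` edition;
  ★ `approxMinimiserExistsTop7MG_of_eu_of_reg` (§3 at any `C₁ ≥ 1` ⇐ NAME ∧ K0's (R)-name `Node00.VariationalThm1RegSepTop7MG`: a minimiser is an approximate minimiser) ⇒
  ★ `variationalThm1EUSepTop7MG_iff_approxExists_of_step_of_reg` (MODULO the step token and (R), the (E∕U) name IS the supply token); bookkeeping `.anti` (guard), `.of_le` (ceilings),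
  `.of_C₁_le` ∕ `.mono` (the constant `C₁`); the (14) accessors and `ApproxMinTop.of_le`, `approxMinTop_of_reg`.

LOCATED (for the planner ∕ an N07 or NODE-00 producer; nothing flagged).
(ℓ1) NO REALISED-DATA SHORTCUT.  N12's junction instantiates the (E∕U) letter at REALISED data `W := avgFamily av (qsstarGIter0 (k i) (ext i Vk))` (`B15Prop1Thm1RowsOfExistsUniqueAtLength`
:173), and `U* := qsstarGIter0 …` does satisfy the agreement half of (14) trivially — but NOT the regularity half: the fine plaquette variables of a `Q_k^{s*}`-filling ARE the coarse
plaquette variables, raw (`B15Prop1DatumSmall7AtZSequence.plaqHol_qsstarGIter0_dichotomy`), not `·η_n²`-small; `U*` is not in class (6).  So print's induction (the producer of §3 at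
lengths `k ≥ 2` from the name + (R) at length `k − 1` over the TRUNCATED index — r11's `Seq` normalises `Ω_j = ∅` off `1 ≤ j ≤ k`, and `genSet`∕`gammaRegion` read `Ω_1, …, Ω_k` only, so
dropping `Ω_{k}` gives `Γ'_{k−1} = Ω_{k−1} ⊇ Λ_{k−1} ∪ Ω_k` = print's `Λ'_{k−1} = Λ_{k−1} ∪ B(Λ_k)` and UNCHANGED class ranges `omegaPlaqsTop ∕ omegaBondsTop` at the scales `≤ k−1`) IS on
N12's path.  Not typed here (one `def Seq.trunc` + the (11) datum + (ℓ2)).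
(ℓ2) INTERFACE SOLVABILITY.  In the tree's convention `bondsOf S = {b | b.src ∈ S ∨ b.tgt ∈ S}` ([I] p.251 reading (b)) a scale-`j` bond STICKING OUT of `Ω_j` is constrained, and
Bałaban's (0.4) average `blockAvg` at it reads scale-`(j−1)` bonds of the collar block, which are pinned to `W (j−1)`; the exact constraint must then be met from the free block alone.
Hence the (E) clause of the name — and §3, and print's lift (11)–(13) — contain a small-data SOLVABILITY statement at interfaces that print's (3) «U_j = V on Λ_j» with the `V̄`-rule of
(7) never meets.  Presumably true at the name's `a₁` (an implicit-function ∕ degree count: `d·L^d` free bond variables per block against `2d` equations per coarse site); recorded as a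
range note for whoever produces §3, not as a defect of the name.
(ℓ3) WHAT A PRODUCER OF §2 ADDS TO PRINT (from the lane's `N12-H15EU-ORPHAN-2026-08-29.md` §5): uniqueness modulo tower-CENTRAL gauges needs, at reducible data, the
conjugation-EQUIVARIANCE of the gauge-fixed chart (S-sized); typed abstract pieces already in the tree: `B11Eq129Minimizer`, `B11Eq120SolutionContinuity ∕ Lipschitz`,
`B11CriticalSlice`, `B11Eq142LocalMin`, `B11Eq127EulerLagrange`, `B11Eq81Expansion`; [6] Thm 2 at the Setup torus `B8Thm2SetupTorus` (N05, a discharged node).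

HONEST SCOPE.  Two more NAMED `Prop`s (never asserted) and by-name reductions between named `Prop`s none of which is produced in the tree; nothing of Bałaban's analysis asserted or
proved; count-neutral; K0⁷ ∕ K1⁹ NOT closed; N12 NOT discharged; the YM mass gap (Clay) is NOT proved by any of this.

References: [15] (1) p.277, (2)–(7) p.278, Thm 1 (8) p.279, (11) p.279, (12)–(14) p.280, (15)–(21) pp.280–281, Prop. 2 p.281, (141)–(142) p.299; [6] = [Balaban1985RegularSpaces]
(1.3)–(1.9) p.77, Thm 2; [III] = [Balaban1988Convergent] (2.2) p.255, (2.10)–(2.12) p.256, (2.18) p.257; [I] = [Balaban1987RG1] (0.1) p.251, (0.4) p.253.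
-/

noncomputable section

namespace Literature.MathematicalPhysics.QuantumFieldTheory.Balaban1983to89.B11Thm1ExistsUniqueStepTokensG

open T4Continuum B15DeterminingSets GaugeField Node00
open B16Sect1Backgrounds (toMS)
open B11Thm1ExistsUniqueCoP7MG (VariationalThm1EUSepTop7MG VariationalThm1EUSepCoP7MG)

/-! ## §1  Print's (14): approximate minimisers -/

section Approx

variable {P : Params} {N : ℕ} [NeZero N]

/-- **[15] (14) p. 280 — AN APPROXIMATE MINIMISER `U₀` FOR THE DATUM `W` ALONG `{Ω_j}` ON THE TOP DOMAIN `Ω₀`**: *«U₀ ∈ U_k({Ω_j}, C₁B₃ε₁), |U₀ − V| < C₁ε₁ on Λ_j, j = 0, 1, …,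
k»* read in NODE 00's house with per-scale thresholds `ρ_n` (print: `ρ_n = C₁B₃ε₁`): `U₀` is `ρ_n·η_n²`-small on the plaquettes meeting `Ω_n` (`Ω₀` at `n = 0`), its co-divergence is
`ρ_n·η_n³`-small on the bonds meeting `Ω_n` — the two clauses of [6] (1.3)∕(1.9) in the SHAPE of (8)'s conclusion — and its averages AGREE with `W` on the determining set `genSet Ω k`
(print's closeness at distance zero).
-- TODO(general form): print allows `|U₀ − V| < C₁ε₁` on `Λ_j`; exact agreement is the special case Theorem 1's own proof uses ((13), and `U₀ = V₀` at `k = 1`).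
[cite: Balaban1985Variational, (14) p.280, (2)–(3) p.278; Balaban1985RegularSpaces, (1.3)–(1.9) p.77; Balaban1988Convergent, (2.2) p.255, (2.10)–(2.11) p.256] -/
def ApproxMinTop (av : ∀ j, Averaging P j (SU N)) (Ω : ℕ → Set (Site P 0)) (Ω₀ : Set (Site P 0)) (k : ℕ) (ρ : ℕ → ℝ) (W : MSField P (SU N))
    (U₀ : GaugeField P 0 (SU N)) : Prop :=
  (∀ n, n ≤ k → PlaqSmallOn (Sect2.omegaPlaqsTop Ω Ω₀ n) (ρ n * P.eta n ^ 2) U₀) ∧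
    (∀ n, n ≤ k → Sect2.CoDivSmallOn (Sect2.omegaBondsTop Ω Ω₀ n) (ρ n * P.eta n ^ 3) U₀) ∧
      AgreeOn (genSet Ω k) (avgFamily av U₀) W


end Approx

/-! ## §2  The one-length step tokens ([15] Prop. 2 + Sects. B–E, given an approximate minimiser) -/

section Tokens

variable (F : T4Family) (N : ℕ) [NeZero N]

/-- **★ NAMED TOKEN — [15] THEOREM 1 (E∕U) AT ONE LENGTH, GIVEN AN APPROXIMATE MINIMISER WITH (14)** (a `Prop` with parameters, NEVER asserted; guard-generic, top-domain
selector `Sup`): the binders of `B11Thm1ExistsUniqueCoP7MG.VariationalThm1EUSepTop7MG` VERBATIM (numerics `ν`, cube letter `M`, couplings `g`, torus `K`, length `0 < k`, separated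
(2.18) index `s` of record, `0 < ν.M₁`, guard `Adm`, thresholds `0 < δ_n ≤ a₁`, `B₃δ_n ≤ ε₀ ≤ a₀` comparable both ways, datum `W` with (7) on the support), then: FOR EVERY
configuration `U₀` satisfying (14) at the thresholds `C₁B₃δ_n` for THIS `(s, W)`, the (E∕U) conclusion at `(s, W)` — a minimiser of (5) over the class (6) at `ε₀` with the data
`W` on `genSet s.Ω k` EXISTS, and any two such minimisers differ by a gauge transformation whose scale-`n` images at the two ends of every constrained bond are equal and central.
This is print's Sects. A–E read as ONE sentence: *«Proposition 2. All critical orbits of the functional (5) in the space (6) … can be obtained by taking critical configurations U₁ of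
the functional A(U₁U₀) in the space defined by (19)–(21), where U₀ satisfies (14)»* and *«In the next four sections we will study the variational problem in the space (19)–(21).
We will prove that for ε₁, ε₂ sufficiently small there exists exactly one critical configuration, which is a minimum of the functional (5)»* (p. 281).  NO producer in the tree.
-- TODO(general form): print's (14) with `|U₀ − V| < C₁ε₁`; the orbit group (4) read modulo the centre; general admissible `{Ω_j}`; one threshold `ε₁`.
[cite: Balaban1985Variational, (14) p.280, (15)–(21) pp.280–281, Prop. 2 p.281, (141)–(142) p.299, Thm 1 p.279; Balaban1985RegularSpaces, (1.3)–(1.9) p.77; Balaban1988Convergent, (2.2) p.255, (2.12) p.256, (2.18) p.257] -/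
def VariationalThm1EUStepTop7MG (Sup : (ν : Stage7Numerics) → (K : ℕ) → (ℕ → Set (Site (F.P K) 0)) → Set (Site (F.P K) 0)) (Adm : StepGuard F) (C₁ B₃ a₀ a₁ : ℝ) :
    Prop :=
  ∀ (ν : Stage7Numerics) (M : ℕ) (g : ℕ → ℝ) (K k : ℕ) (s : SeqOfRecord F ν M g K k), 0 < k → Sect2.SeqSeparated ν.M₁ s → 0 < ν.M₁ → Adm ν M g K k s → ∀ (ε₀ : ℝ) (δ : ℕ → ℝ),
    (∀ n, n ≤ k → 0 < δ n ∧ δ n ≤ a₁ ∧ B₃ * δ n ≤ ε₀) → (∀ n, n < k → δ n ≤ 2 * δ (n + 1)) → (∀ n, n < k → δ (n + 1) ≤ 2 * δ n) → ε₀ ≤ a₀ →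
    ∀ W : MSField (F.P K) (SU N), Sect2.DataSmall7PTop (avOfRecord F N K) s.Ω (Sup ν K s.Ω) k δ W →
      ∀ U₀ : GaugeField (F.P K) 0 (SU N), ApproxMinTop (avOfRecord F N K) s.Ω (Sup ν K s.Ω) k (fun n => C₁ * B₃ * δ n) W U₀ →
      (∃ U : GaugeField (F.P K) 0 (SU N), IsMinimizer (avOfRecord F N K)
          {U | (∀ n, n ≤ k → PlaqSmallOn (Sect2.omegaPlaqsTop s.Ω (Sup ν K s.Ω) n) (ε₀ * (F.P K).eta n ^ 2) U) ∧
            Sect2.CoDivClassOnTop s.Ω (Sup ν K s.Ω) k ε₀ U} (genSet s.Ω k) W U) ∧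
      ∀ U₁ U₂ : GaugeField (F.P K) 0 (SU N),
        IsMinimizer (avOfRecord F N K)
            {U | (∀ n, n ≤ k → PlaqSmallOn (Sect2.omegaPlaqsTop s.Ω (Sup ν K s.Ω) n) (ε₀ * (F.P K).eta n ^ 2) U) ∧
              Sect2.CoDivClassOnTop s.Ω (Sup ν K s.Ω) k ε₀ U} (genSet s.Ω k) W U₁ →
        IsMinimizer (avOfRecord F N K)
            {U | (∀ n, n ≤ k → PlaqSmallOn (Sect2.omegaPlaqsTop s.Ω (Sup ν K s.Ω) n) (ε₀ * (F.P K).eta n ^ 2) U) ∧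
              Sect2.CoDivClassOnTop s.Ω (Sup ν K s.Ω) k ε₀ U} (genSet s.Ω k) W U₂ →
        ∃ u : GaugeTransf (F.P K) 0 (SU N),
          (∀ n, n ≤ k → ∀ b ∈ bondsOf (genSet s.Ω k n), toMS u n b.src = toMS u n b.tgt ∧ ∀ g : SU N, toMS u n b.src * g = g * toMS u n b.src) ∧
            gaugeAct u U₁ = U₂

/-- **★★ NAMED TOKEN, `CoP` EDITION — [15] THEOREM 1 (E∕U) AT ONE LENGTH GIVEN AN APPROXIMATE MINIMISER, ON THE SUPPORT OF RECORD `suppDomOfRecord`**: §2's top-domain token at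
node00-def-R's selector (`rfl`) — the currency of the name `VariationalThm1EUSepCoP7MG` the junction of record reads.  The token an (E∕U) producer item would be filed against,
exactly as K0's stub 1 is filed against `Node00.Prop8RegSepTopStepG`'s `CoP` instance.  A `Prop` with parameters, NEVER asserted; NO producer in the tree.
-- TODO(general form): as above.
[cite: Balaban1985Variational, (14) p.280, Prop. 2 p.281, (141)–(142) p.299; Balaban1988Convergent, p.255, (2.12) p.256] -/
def VariationalThm1EUStepCoP7MG (Adm : StepGuard F) (C₁ B₃ a₀ a₁ : ℝ) : Prop :=
  VariationalThm1EUStepTop7MG F N (fun ν K Ω => suppDomOfRecord F ν K Ω) Adm C₁ B₃ a₀ a₁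

/-! ## §3  The supply tokens ([15] (11)–(13): an approximate minimiser exists) -/

/-- **NAMED TOKEN — AN APPROXIMATE MINIMISER WITH (14) EXISTS** (a `Prop` with parameters, NEVER asserted): under the binders of `VariationalThm1EUSepTop7MG` VERBATIM, for every
datum `W` with (7) there is a configuration `U₀` satisfying (14) at the thresholds `C₁B₃δ_n`.  In print this is what the induction on `k` supplies: (11) *«We can easily construct a
configuration V₀ on 𝔅′_{k−1} such that it satisfies (7) on 𝔅′_{k−1}, and V₀ = V on ⋃_{j<k} Λ_j, V̄₀ = V on Λ_k»*, (12)–(13) the length-`(k−1)` minimiser `U₀ = U_{k−1}(V₀)` is in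
`U_k({Ω_j}, B₃L³ε₁) ∩ 𝔘_k(𝔅_k, V)` (so `C₁ = L³`), and at `k = 1` *«we take simply U₀ = V₀»*.  In the tree's `bondsOf`-MEETING convention the constraints at coarse bonds sticking out of
`Ω_j` make even the `k = 1` case a small-data solvability statement (module docstring (ℓ2)).  NO producer in the tree.
-- TODO(general form): print's (11)–(13) for general admissible `{Ω_j}`; print's constraint convention «U_j = V on Λ_j» has no sticking-out bonds.
[cite: Balaban1985Variational, (11) p.279, (12)–(14) p.280; Balaban1985RegularSpaces, (1.3)–(1.9) p.77; Balaban1988Convergent, (2.2) p.255, (2.10)–(2.12) p.256, (2.18) p.257] -/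
def ApproxMinimiserExistsTop7MG (Sup : (ν : Stage7Numerics) → (K : ℕ) → (ℕ → Set (Site (F.P K) 0)) → Set (Site (F.P K) 0)) (Adm : StepGuard F) (C₁ B₃ a₀ a₁ : ℝ) :
    Prop :=
  ∀ (ν : Stage7Numerics) (M : ℕ) (g : ℕ → ℝ) (K k : ℕ) (s : SeqOfRecord F ν M g K k), 0 < k → Sect2.SeqSeparated ν.M₁ s → 0 < ν.M₁ → Adm ν M g K k s → ∀ (ε₀ : ℝ) (δ : ℕ → ℝ),
    (∀ n, n ≤ k → 0 < δ n ∧ δ n ≤ a₁ ∧ B₃ * δ n ≤ ε₀) → (∀ n, n < k → δ n ≤ 2 * δ (n + 1)) → (∀ n, n < k → δ (n + 1) ≤ 2 * δ n) → ε₀ ≤ a₀ →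
    ∀ W : MSField (F.P K) (SU N), Sect2.DataSmall7PTop (avOfRecord F N K) s.Ω (Sup ν K s.Ω) k δ W →
      ∃ U₀ : GaugeField (F.P K) 0 (SU N), ApproxMinTop (avOfRecord F N K) s.Ω (Sup ν K s.Ω) k (fun n => C₁ * B₃ * δ n) W U₀

/-- **NAMED TOKEN, `CoP` EDITION — AN APPROXIMATE MINIMISER EXISTS, ON THE SUPPORT OF RECORD.** [cite: Balaban1985Variational, (11) p.279, (12)–(14) p.280; Balaban1988Convergent, p.255, (2.12) p.256] -/
def ApproxMinimiserExistsCoP7MG (Adm : StepGuard F) (C₁ B₃ a₀ a₁ : ℝ) : Prop :=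
  ApproxMinimiserExistsTop7MG F N (fun ν K Ω => suppDomOfRecord F ν K Ω) Adm C₁ B₃ a₀ a₁

variable {F N}

/-- The `CoP` step token IS the top-domain token at node00-def-R's selector (definitional). [cite: Balaban1985Variational, Prop. 2 p.281 (bookkeeping)] -/
theorem variationalThm1EUStepCoP7MG_iff {Adm : StepGuard F} {C₁ B₃ a₀ a₁ : ℝ} :
    VariationalThm1EUStepCoP7MG F N Adm C₁ B₃ a₀ a₁ ↔ VariationalThm1EUStepTop7MG F N (fun ν K Ω => suppDomOfRecord F ν K Ω) Adm C₁ B₃ a₀ a₁ := Iff.rfl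

/-- The `CoP` supply token IS the top-domain token at node00-def-R's selector (definitional). [cite: Balaban1985Variational, (14) p.280 (bookkeeping)] -/
theorem approxMinimiserExistsCoP7MG_iff {Adm : StepGuard F} {C₁ B₃ a₀ a₁ : ℝ} :
    ApproxMinimiserExistsCoP7MG F N Adm C₁ B₃ a₀ a₁ ↔ ApproxMinimiserExistsTop7MG F N (fun ν K Ω => suppDomOfRecord F ν K Ω) Adm C₁ B₃ a₀ a₁ := Iff.rfl

end Tokens


end Literature.MathematicalPhysics.QuantumFieldTheory.Balaban1983to89.B11Thm1ExistsUniqueStepTokensG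

end
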